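import Mathlib
import Literature.Computability.AlgebraicComplexity.PrattTrapezoidVal
import Literature.Computability.AlgebraicComplexity.LocalStrongUSP
import Summits.MatrixMultiplication.MatrixMultiplication.Theorems.SoloBlindPrattValCyclic
import Summits.MatrixMultiplication.MatrixMultiplication.Theorems.SoloBlindLocalStrongUSP8

/-!
# `Val(K³) > |K|³` for every finite abelian group `K` with `|K| ≥ 5`

Solo-blind line Q12 (Pratt, arXiv:2309.03878), sixth file.  Pratt's `Val(G)` (tree: `prattVal`) is
defined for every finite abelian group, with `Val(G) ≥ |G|` (`card_le_prattVal`).  The width-3 local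
strong USP `{123, 231}` in `K × K × K` (CKSU 2005 Thm. 33 needs no coprimality; tree:
`soloVal_le_prattVal_pi_of_isLocalStrongUSP`) gives `Val(K³) ≥ 2(|K| − 1)³`, which exceeds `|K|³` as
soon as `|K| ≥ 5`; in particular `Val((ℤ/5ℤ)³) ≥ 128 > 125`, an abelian group of order `125 < 140`
whose `Val` exceeds its order (for cyclic groups the least modulus this seat knows is `140`, and a
SAT census gives `Val(G) = |G|` for all abelian `G` of order `≤ 12` and all cyclic `G` of order
`≤ 16`).  The width-8 puzzle gives `Val(K⁸) ≥ 8(|K| − 1)⁸ > |K|⁸` for `|K| ≥ 5` as well, and for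
`𝔽₂`-vector spaces no USP-type configuration can exceed the order (the USP capacity is `< 2`), which
is why `K = ℤ/2ℤ` is excluded by every statement here.
-/

set_option linter.dupNamespace false

namespace Summit.MatrixMultiplication.MatrixMultiplication.Theorems

open Finset Literature.Computability.AlgebraicComplexity

/-- **`2 · (|K| − 1)³ ≤ Val(K³)`** for every finite abelian group `K`. -/
theorem soloVal_cube_le_prattVal (K : Type*) [AddCommGroup K] [Fintype K] [DecidableEq K] :
    2 * (Fintype.card K - 1) ^ 3 ≤ prattVal (Fin 3 → K) := by
  have h := soloVal_le_prattVal_pi_of_isLocalStrongUSP (K := fun _ : Fin 3 => K)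
    soloVal_isLocalStrongUSP_axesPair
  simpa [Finset.prod_const, Finset.card_univ, Fintype.card_fin] using h

/-- **`8 · (|K| − 1)⁸ ≤ Val(K⁸)`** for every finite abelian group `K` (width-8 puzzle). -/
theorem soloVal_eighth_le_prattVal (K : Type*) [AddCommGroup K] [Fintype K] [DecidableEq K] :
    8 * (Fintype.card K - 1) ^ 8 ≤ prattVal (Fin 8 → K) := by
  have h := soloVal_le_prattVal_pi_of_isLocalStrongUSP (K := fun _ : Fin 8 => K)
    soloVal_isLocalStrongUSP_width8
  simpa [Finset.prod_const, Finset.card_univ, Fintype.card_fin] using h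

/-- **`Val(K³) > |K³|` whenever `|K| ≥ 5`** (`2 (q−1)³ > q³` iff `q ≥ 5`). -/
theorem soloVal_card_cube_lt_prattVal (K : Type*) [AddCommGroup K] [Fintype K] [DecidableEq K]
    (h5 : 5 ≤ Fintype.card K) : Fintype.card (Fin 3 → K) < prattVal (Fin 3 → K) := by
  have h := soloVal_cube_le_prattVal K
  rw [Fintype.card_fun, Fintype.card_fin]
  obtain ⟨q, hq⟩ : ∃ q, Fintype.card K = q := ⟨_, rfl⟩
  rw [hq] at h h5 ⊢
  have h1 : q ^ 3 < 2 * (q - 1) ^ 3 := by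
    obtain ⟨r, rfl⟩ : ∃ r, q = r + 5 := ⟨q - 5, by omega⟩
    rw [show r + 5 - 1 = r + 4 by omega]
    ring_nf
    nlinarith [sq_nonneg r]
  omega

/-- **`Val((ℤ/5ℤ)³) ≥ 128 > 125`.** -/
theorem soloVal_prattVal_zmod5_cube : 128 ≤ prattVal (Fin 3 → ZMod 5) := by
  simpa using soloVal_cube_le_prattVal (ZMod 5)

/-- `|(ℤ/5ℤ)³| = 125 < Val((ℤ/5ℤ)³)`. -/
theorem soloVal_card_lt_prattVal_zmod5_cube :
    Fintype.card (Fin 3 → ZMod 5) < prattVal (Fin 3 → ZMod 5) :=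
  soloVal_card_cube_lt_prattVal (ZMod 5) (by simp)

end Summit.MatrixMultiplication.MatrixMultiplication.Theorems
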